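import Summits.KontsevichZagierPeriods.KontsevichZagierPeriods.Theorems.LiouvilleUnfoldingAyoubPiLocalKernel
import Summits.KontsevichZagierPeriods.KontsevichZagierPeriods.Theorems.TerasomaMultiplicationBetaCancellationOfAyoubPiCancellation
import Literature.NumberTheory.Transcendental.KZCalculusProofs
import Literature.NumberTheory.Transcendental.KZKernelConjectureForms

/-!
# `AyoubPiLocalKernel` (stmt-KontsevichZagierPeriods-0541) — negative knowledge: load-bearing hypotheses

The crux (route LiouvilleUnfolding; `= KZ.PiLocalKernel`, Ayoub's Conjecture 7 for the four-move
calculus) reads: for every PINNED family `P n r = [unit disc] × r` and every formal combination `c`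
with `KZ.eval c = 0`, some iterate `(lift (of ∘ P))^[N] c` is a relation. Each statement below is the
crux VERBATIM with one hypothesis deleted or one constant mutated (inlined, no new `Prop`):

* SOUNDNESS SIDE (`eval_lift_iterate`, `eval_eq_zero_of_lift_iterate_mem`): the conclusion implies the
  hypothesis `eval c = 0` — the crux is an `iff` per element (`ayoubPiLocalKernel_iff_forall_iff`).
* `eval c = 0` deleted: FALSE (`ayoubPiLocalKernel_false_without_evalZero`; witness `c = [π]`).
* the pinning deleted (ANY family `P : ∀ n, IntegralRep n → IntegralRep (n + 2)`): the statement is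
  LITERALLY the summit's kernel form (`withoutPinning_iff_kzKernelConjecture`, witness family
  `(r.slab 0).slab 0`, two Newton–Leibniz moves from `r`) — so no `_false_without_pinning` theorem
  exists short of disproving Conjecture 1; only the multiplier `[π]` can make 0541 weaker than the
  summit.
* the multiplier mutated to an integer `k`: `k = 0` trivially TRUE (`natLocalKernel_zero`), `k ≥ 1`
  again the summit's kernel form (`natLocalKernel_iff_kzKernelConjecture`, no torsion modulo the four
  moves).
* the exponent pinned to `N = 0` (strengthening): the summit (`exponentZero_iff_kzKernelConjecture`).
[cite: Ayoub2014, Def. 6 and Conj. 7] [cite: KontsevichZagierPeriods2001, §1.2 Conjecture 1 and §4.1]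
-/

noncomputable section

open MeasureTheory Set
open Literature.NumberTheory.Transcendental
open Literature.NumberTheory.Transcendental.KZ

namespace Summit.KontsevichZagierPeriods.LiouvilleUnfolding.AyoubPiLocalKernelNegative

open Summit.KontsevichZagierPeriods.KontsevichZagierPeriods.Theses.LiouvilleUnfolding
  (AyoubPiLocalKernel)
open Summit.KontsevichZagierPeriods.KontsevichZagierPeriods.BetaCancellationLine
  (exists_pinned piRep_mul_sub_lift_mem_relations pinned_eq_piRep_prod_reindex)

/-! ## The pinned family is unique; soundness side -/

/-- **The pinned family is unique**: domain and integrand are pinned and the other fields of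
`KZ.IntegralRep` are proofs, so `∀ P, pinned P → …` ranges over exactly one (inhabited,
`BetaCancellationLine.exists_pinned`) object — the interface typing is neither vacuous nor loose.
[folklore] -/
theorem pinned_unique {P P' : ∀ n : ℕ, IntegralRep n → IntegralRep (n + 2)}
    (hP : ∀ (n : ℕ) (r : IntegralRep n),
      (P n r).domain = {z : Fin (n + 2) → ℝ | z 0 ^ 2 + z 1 ^ 2 ≤ 1 ∧
          (fun i : Fin n => z i.succ.succ) ∈ r.domain} ∧
        (P n r).integrand = fun z => r.integrand (fun i : Fin n => z i.succ.succ))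
    (hP' : ∀ (n : ℕ) (r : IntegralRep n),
      (P' n r).domain = {z : Fin (n + 2) → ℝ | z 0 ^ 2 + z 1 ^ 2 ≤ 1 ∧
          (fun i : Fin n => z i.succ.succ) ∈ r.domain} ∧
        (P' n r).integrand = fun z => r.integrand (fun i : Fin n => z i.succ.succ)) :
    P = P' := by
  funext n r
  rw [pinned_eq_piRep_prod_reindex P hP n r, pinned_eq_piRep_prod_reindex P' hP' n r]

/-- `eval ∘ lift (of ∘ P) = π · eval` for a pinned family (`lift (of ∘ P) c ≡ [π] * c` modulo
relations, soundness of the moves, Fubini `KZ.eval_piRep_mul`). [folklore] -/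
theorem eval_lift (P : ∀ n : ℕ, IntegralRep n → IntegralRep (n + 2))
    (hP : ∀ (n : ℕ) (r : IntegralRep n),
      (P n r).domain = {z : Fin (n + 2) → ℝ | z 0 ^ 2 + z 1 ^ 2 ≤ 1 ∧
          (fun i : Fin n => z i.succ.succ) ∈ r.domain} ∧
        (P n r).integrand = fun z => r.integrand (fun i : Fin n => z i.succ.succ))
    (c : FormalRep) :
    eval (FreeAbelianGroup.lift (fun s : (Σ n, IntegralRep n) => of (P s.1 s.2)) c) =
      Real.pi * eval c := by
  have h0 : eval (of piRep * c -
      FreeAbelianGroup.lift (fun s : (Σ n, IntegralRep n) => of (P s.1 s.2)) c) = 0 :=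
    relations_le_ker_eval_holds (piRep_mul_sub_lift_mem_relations P hP c)
  rw [map_sub, eval_piRep_mul, sub_eq_zero] at h0
  exact h0.symm

/-- `eval ((lift (of ∘ P))^[N] c) = π ^ N · eval c`. [folklore] -/
theorem eval_lift_iterate (P : ∀ n : ℕ, IntegralRep n → IntegralRep (n + 2))
    (hP : ∀ (n : ℕ) (r : IntegralRep n),
      (P n r).domain = {z : Fin (n + 2) → ℝ | z 0 ^ 2 + z 1 ^ 2 ≤ 1 ∧
          (fun i : Fin n => z i.succ.succ) ∈ r.domain} ∧
        (P n r).integrand = fun z => r.integrand (fun i : Fin n => z i.succ.succ))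
    (N : ℕ) (c : FormalRep) :
    eval ((⇑(FreeAbelianGroup.lift (fun s : (Σ n, IntegralRep n) => of (P s.1 s.2))))^[N] c) =
      Real.pi ^ N * eval c := by
  induction N with
  | zero => simp
  | succ N ih => rw [Function.iterate_succ_apply', eval_lift P hP, ih, pow_succ]; ring

/-- **Tightness — the conclusion of the crux implies its hypothesis**: if some `[π]`-power multiple
of `c` is a relation then `eval c = 0` (soundness and `π ≠ 0`). [folklore] -/
theorem eval_eq_zero_of_lift_iterate_mem (P : ∀ n : ℕ, IntegralRep n → IntegralRep (n + 2))
    (hP : ∀ (n : ℕ) (r : IntegralRep n),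
      (P n r).domain = {z : Fin (n + 2) → ℝ | z 0 ^ 2 + z 1 ^ 2 ≤ 1 ∧
          (fun i : Fin n => z i.succ.succ) ∈ r.domain} ∧
        (P n r).integrand = fun z => r.integrand (fun i : Fin n => z i.succ.succ))
    {c : FormalRep} {N : ℕ}
    (h : (⇑(FreeAbelianGroup.lift (fun s : (Σ n, IntegralRep n) => of (P s.1 s.2))))^[N] c ∈
      relations) :
    eval c = 0 := by
  have h0 : eval ((⇑(FreeAbelianGroup.lift
      (fun s : (Σ n, IntegralRep n) => of (P s.1 s.2))))^[N] c) = 0 :=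
    relations_le_ker_eval_holds h
  rw [eval_lift_iterate P hP] at h0
  exact (mul_eq_zero.mp h0).resolve_left (pow_ne_zero _ Real.pi_ne_zero)

/-- The crux per element is an `iff`: `AyoubPiLocalKernel ↔ ∀ P pinned, ∀ c,
(eval c = 0 ↔ ∃ N, (lift (of ∘ P))^[N] c ∈ relations)`. [folklore] -/
theorem ayoubPiLocalKernel_iff_forall_iff :
    AyoubPiLocalKernel ↔ ∀ P : ∀ n : ℕ, IntegralRep n → IntegralRep (n + 2),
      (∀ (n : ℕ) (r : IntegralRep n),
        (P n r).domain = {z : Fin (n + 2) → ℝ | z 0 ^ 2 + z 1 ^ 2 ≤ 1 ∧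
            (fun i : Fin n => z i.succ.succ) ∈ r.domain} ∧
          (P n r).integrand = fun z => r.integrand (fun i : Fin n => z i.succ.succ)) →
      ∀ c : FormalRep, (eval c = 0 ↔ ∃ N : ℕ,
        (⇑(FreeAbelianGroup.lift (fun s : (Σ n, IntegralRep n) => of (P s.1 s.2))))^[N] c ∈
          relations) := by
  refine forall₂_congr fun P hP => forall_congr' fun c => ?_
  exact ⟨fun h => ⟨h, fun ⟨N, hN⟩ => eval_eq_zero_of_lift_iterate_mem P hP hN⟩, fun h => h.1⟩

/-! ## `eval c = 0` is load-bearing -/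

/-- **Any proof must use `eval c = 0`**: the crux VERBATIM with that hypothesis deleted is FALSE.
Witness: the pinned family and `c = [π]` (value `π ≠ 0`). [folklore] -/
theorem ayoubPiLocalKernel_false_without_evalZero :
    ¬ ∀ P : ∀ n : ℕ, IntegralRep n → IntegralRep (n + 2),
      (∀ (n : ℕ) (r : IntegralRep n),
        (P n r).domain = {z : Fin (n + 2) → ℝ | z 0 ^ 2 + z 1 ^ 2 ≤ 1 ∧
            (fun i : Fin n => z i.succ.succ) ∈ r.domain} ∧
          (P n r).integrand = fun z => r.integrand (fun i : Fin n => z i.succ.succ)) →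
      ∀ c : FormalRep, ∃ N : ℕ,
        (⇑(FreeAbelianGroup.lift (fun s : (Σ n, IntegralRep n) => of (P s.1 s.2))))^[N] c ∈
          relations := by
  intro h
  obtain ⟨P, hP⟩ := exists_pinned
  obtain ⟨N, hN⟩ := h P hP (of piRep)
  have h0 := eval_eq_zero_of_lift_iterate_mem P hP hN
  rw [eval_of_piRep] at h0
  exact Real.pi_ne_zero h0

/-! ## The pinning is what could separate the crux from the summit -/

/-- `[(r.slab 0).slab 0] − [r] ∈ relations`: two printed rule-(3) moves. [folklore] -/
theorem of_slab_slab_sub_mem {n : ℕ} (r : IntegralRep n) :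
    of ((r.slab 0).slab 0) - of r ∈ relations := by
  have h1 : of ((r.slab 0).slab 0) - of (r.slab 0) ∈ relations :=
    newtonLeibnizRel_subset_relations ((r.slab 0).of_slab_sub_of_mem_newtonLeibnizRel 0)
  have h2 : of (r.slab 0) - of r ∈ relations :=
    newtonLeibnizRel_subset_relations (r.of_slab_sub_of_mem_newtonLeibnizRel 0)
  have e : of ((r.slab 0).slab 0) - of r =
      (of ((r.slab 0).slab 0) - of (r.slab 0)) + (of (r.slab 0) - of r) := by abel
  rw [e]
  exact relations.add_mem h1 h2

/-- For the double-slab family, `lift (of ∘ P) c ≡ c` modulo relations. [folklore] -/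
theorem lift_slab_slab_sub_mem (c : FormalRep) :
    FreeAbelianGroup.lift (fun s : (Σ n, IntegralRep n) => of ((s.2.slab 0).slab 0)) c - c ∈
      relations := by
  induction c using FreeAbelianGroup.induction_on with
  | zero => simp [relations.zero_mem]
  | of s =>
    obtain ⟨n, r⟩ := s
    rw [FreeAbelianGroup.lift_apply_of]
    exact of_slab_slab_sub_mem r
  | neg s ih =>
    have e : FreeAbelianGroup.lift (fun s : (Σ n, IntegralRep n) => of ((s.2.slab 0).slab 0))
          (-FreeAbelianGroup.of s) - -FreeAbelianGroup.of s =
        -(FreeAbelianGroup.lift (fun s : (Σ n, IntegralRep n) => of ((s.2.slab 0).slab 0))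
          (FreeAbelianGroup.of s) - FreeAbelianGroup.of s) := by
      rw [map_neg]; abel
    rw [e]
    exact relations.neg_mem ih
  | add x y hx hy =>
    rw [map_add]
    have e : FreeAbelianGroup.lift (fun s : (Σ n, IntegralRep n) => of ((s.2.slab 0).slab 0)) x +
        FreeAbelianGroup.lift (fun s : (Σ n, IntegralRep n) => of ((s.2.slab 0).slab 0)) y -
          (x + y) =
        (FreeAbelianGroup.lift (fun s : (Σ n, IntegralRep n) => of ((s.2.slab 0).slab 0)) x - x) +
          (FreeAbelianGroup.lift (fun s : (Σ n, IntegralRep n) => of ((s.2.slab 0).slab 0)) y -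
            y) := by
      abel
    rw [e]
    exact relations.add_mem hx hy

/-- Iterates of the double-slab family: `(lift (of ∘ P))^[N] c ≡ c` modulo relations. [folklore] -/
theorem lift_slab_slab_iterate_sub_mem (N : ℕ) (c : FormalRep) :
    (⇑(FreeAbelianGroup.lift
        (fun s : (Σ n, IntegralRep n) => of ((s.2.slab 0).slab 0))))^[N] c - c ∈ relations := by
  induction N with
  | zero => simp [relations.zero_mem]
  | succ N ih =>
    rw [Function.iterate_succ_apply']
    set b := (⇑(FreeAbelianGroup.lift
        (fun s : (Σ n, IntegralRep n) => of ((s.2.slab 0).slab 0))))^[N] c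
    have e : FreeAbelianGroup.lift (fun s : (Σ n, IntegralRep n) => of ((s.2.slab 0).slab 0)) b -
        c = (FreeAbelianGroup.lift
          (fun s : (Σ n, IntegralRep n) => of ((s.2.slab 0).slab 0)) b - b) + (b - c) := by
      abel
    rw [e]
    exact relations.add_mem (lift_slab_slab_sub_mem b) ih

/-- **Pinning deleted = the summit's kernel form, literally.** The crux VERBATIM with the pinning
hypothesis deleted (any family `P : ∀ n, IntegralRep n → IntegralRep (n + 2)`) is equivalent to
`KZKernelConjecture` (`→`: at `P n r := (r.slab 0).slab 0` the iterates are `≡ c`; `←`: `N = 0`).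
Hence no `_false_without_pinning` theorem can exist short of disproving Conjecture 1, and only the
multiplier `[π]` can make item 0541 weaker than the summit. [folklore] -/
theorem withoutPinning_iff_kzKernelConjecture :
    (∀ (P : ∀ n : ℕ, IntegralRep n → IntegralRep (n + 2)) (c : FormalRep), eval c = 0 →
      ∃ N : ℕ, (⇑(FreeAbelianGroup.lift
        (fun s : (Σ n, IntegralRep n) => of (P s.1 s.2))))^[N] c ∈ relations) ↔
      KZKernelConjecture := by
  constructor
  · intro h c hc
    obtain ⟨N, hN⟩ := h (fun _ r => (r.slab 0).slab 0) c hc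
    have := relations.sub_mem hN (lift_slab_slab_iterate_sub_mem N c)
    simpa using this
  · intro h P c hc
    exact ⟨0, h c hc⟩

/-- The un-pinned statement is equivalent to the summit. [folklore] -/
theorem withoutPinning_iff_summit :
    (∀ (P : ∀ n : ℕ, IntegralRep n → IntegralRep (n + 2)) (c : FormalRep), eval c = 0 →
      ∃ N : ℕ, (⇑(FreeAbelianGroup.lift
        (fun s : (Σ n, IntegralRep n) => of (P s.1 s.2))))^[N] c ∈ relations) ↔
      _root_.KontsevichZagierPeriods :=
  withoutPinning_iff_kzKernelConjecture.trans
    (kzKernelConjecture_iff_isRational : KZKernelConjecture ↔ _root_.KontsevichZagierPeriods)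

/-! ## Mutating the multiplier to an integer -/

/-- **Degenerate multiplier `0`**: "`ker eval` is `0`-power torsion modulo relations" is TRIVIALLY
TRUE (everything dies after one multiplication) — the analogue of pinning at a null disc. [folklore] -/
theorem natLocalKernel_zero :
    ∀ c : FormalRep, eval c = 0 → ∃ N : ℕ, ((0 : ℕ) ^ N) • c ∈ relations :=
  fun _ _ => ⟨1, by simp [relations.zero_mem]⟩

/-- **Integer multipliers `k ≥ 1` give back the summit's kernel form**: "`ker eval` is `k`-power
torsion modulo relations" `↔ KZKernelConjecture`, because the formal period group has no torsion
(integer division is a derived rule, `MzvKernelInKZ.Negative.mem_relations_of_nsmul_mem`). So a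
multiplier weakens Conjecture 1 at most through a value the four moves cannot cancel; for `[π]` that
cancellation is the open sibling item 0540. [folklore] -/
theorem natLocalKernel_iff_kzKernelConjecture {k : ℕ} (hk : 0 < k) :
    (∀ c : FormalRep, eval c = 0 → ∃ N : ℕ, (k ^ N) • c ∈ relations) ↔ KZKernelConjecture := by
  constructor
  · intro h c hc
    obtain ⟨N, hN⟩ := h c hc
    exact Summit.KontsevichZagierPeriods.MzvKernelInKZ.Negative.mem_relations_of_nsmul_mem
      (pow_pos hk N) hN
  · intro h c hc
    exact ⟨0, by simpa using h c hc⟩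

/-! ## Pinning the exponent -/

/-- **Exponent `0` is the summit**: the crux with `∃ N` strengthened to `N = 0` is
`KZKernelConjecture` (the pinned family exists; `f^[0] = id`). [folklore] -/
theorem exponentZero_iff_kzKernelConjecture :
    (∀ P : ∀ n : ℕ, IntegralRep n → IntegralRep (n + 2),
      (∀ (n : ℕ) (r : IntegralRep n),
        (P n r).domain = {z : Fin (n + 2) → ℝ | z 0 ^ 2 + z 1 ^ 2 ≤ 1 ∧
            (fun i : Fin n => z i.succ.succ) ∈ r.domain} ∧
          (P n r).integrand = fun z => r.integrand (fun i : Fin n => z i.succ.succ)) →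
      ∀ c : FormalRep, eval c = 0 →
        (⇑(FreeAbelianGroup.lift (fun s : (Σ n, IntegralRep n) => of (P s.1 s.2))))^[0] c ∈
          relations) ↔ KZKernelConjecture := by
  constructor
  · intro h c hc
    obtain ⟨P, hP⟩ := exists_pinned
    simpa using h P hP c hc
  · intro h P _ c hc
    simpa using h c hc

end Summit.KontsevichZagierPeriods.LiouvilleUnfolding.AyoubPiLocalKernelNegative

end
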